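import Literature.NumberTheory.Rogawski1990.SingularEllipticTransferCanonical          -- ★ `CanonicalTransferMatrix`
import Literature.NumberTheory.Rogawski1990.UnitFundamentalLemmaExplicitNonsplitClosedProof  -- ★ `unitFundamentalLemmaExplicitNonsplitClosed_holds`
import Literature.NumberTheory.Rogawski1990.UnitFundamentalLemmaExplicitSplit           -- ★ `unitFundamentalLemmaExplicitClosed_of_nonsplitClosed`
import Literature.NumberTheory.Rogawski1990.ExplicitFactorKappaAlmostEverywhereOne       -- ★ `isAlmostEverywhereTrivial_finExplicitCollection_canonical`
import Literature.NumberTheory.Rogawski1990.UnitFundamentalLemmaInertResiduallyRegular    -- ★ `finsum_delta_mul_classOrbitalIntegral_indicator_eq_of_unique`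
import Literature.NumberTheory.Rogawski1990.AdelicStableConjugacyG2                      -- ★ `IsNormPair.isLocalNormPair_toLocal_toAdelic`
import Literature.NumberTheory.Rogawski1990.GRegularLocalisation                         -- ★ `isLocalGRegular_rationalComponent`, `isLocalGRegular_out_mk_rationalComponent`
import Literature.NumberTheory.Automorphic.UnramifiedOrbitalUnitFactorAdelic             -- ★ `exists_isNormalisedOff_adelic_of_isCanonical`
import Literature.NumberTheory.Automorphic.UnramifiedOrbitalUnitFactorSemisimple         -- ★ `eventually_classOrbitalIntegral_indicator_eq_one_of_integralConj`, (KC)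
import Literature.NumberTheory.Automorphic.UnitaryGroupHyperbolicOrbitCompactSupport    -- ★ `charpoly_toLocal_toAdelic_eq_map`
import Literature.NumberTheory.Automorphic.LocalUnitaryGroupUnimodularOfAdelic           -- ★ local unimodularity (rank 2, anisotropic)
import Literature.NumberTheory.Automorphic.OrbitalMeasureFamilyRegular                   -- ★ `isMulRightInvariant_prod`
import Literature.MeasureTheory.Group.RightInvariantIsHaar                              -- ★ `isHaarMeasure_of_isMulRightInvariant_of_ne_zero`
import Summits.HodgeConjecture.HodgeConjecture.Theorems.K2E4WeakMatrixAlmostEverywhereAgreementRationalPair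
import Summits.HodgeConjecture.HodgeConjecture.Theorems.K2E4WeakMatrixAlmostEverywhereAgreementScaling
import HarnessLib

/-!
# K2 · E4 · U1 #20 helper — THE EXPLICIT UNIT FUNDAMENTAL LEMMA HOLDS FOR THE WEAK DATUM'S CANONICAL MEASURE FAMILIES, ALMOST EVERYWHERE

Helper file for `Theorems/K2E4WeakMatrixAlmostEverywhereAgreement.lean` (socket `sig_K2E4WeakMatrixAlmostEverywhereAgreement` of
`Cruxes/H413/Lines/K2_E4_SingularTransferKappaSignSigsWeakMatrixRigidity.lean`, crux H413 = `stmt-HodgeConjecture-24833`, cell `pub/hodgecm-mathlib`,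
Track B «K2-LIT», base K2E4-p20).  THEOREMS ONLY (no `def`, no instance, no notation, no `sorry`).

THE POINT.  The socket's frame carries Haar measures `νH_v` on `H_v = U(Φ₂)(L⁺_v) × U(Φ₁)(L⁺_v)` and `νG_v` on `G′_v = U(H′)(L⁺_v)` with ONLY the
`G′`-side normalisation `νG_v(K′_v) = 1`, and a weak transfer datum `(Sbad, Δ, mH, mG)` satisfying ★ `CanonicalTransferMatrix` (local transfer data,
the unit fundamental lemma off `Sbad`, canonical measure families, almost-everywhere triviality, the product formula).  The tree PROVES the unit
fundamental lemma at the explicit factor `Δ‴_v` (★ `unitFundamentalLemmaExplicitNonsplitClosed_holds` + ★ `unitFundamentalLemmaExplicit_splitHalf`), but for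
canonical families of Haar measures normalised by `νH_v(K_{H,v}) = 1`.  This file shows that the weak datum FORCES that normalisation at almost every
place, hence `1_{K_{H,v}}` is a `Δ‴_v`-transfer of `1_{K′_v}` for the weak datum's own families `(mH v, mG v)` at almost every `v`:
* `νH_v` is a Haar measure (canonical + admissible families sit over a non-zero right-invariant measure; `H_v` is unimodular);
* with `λ_v = νH_v(K_{H,v})` and a rational `G`-regular pair `γ_H → γ` (★ `exists_isGRegular_isNormPair`), read the unit fundamental lemma of `hCTM` for
  `(Δ_v, mH_v, mG_v)` and the explicit one for `(Δ‴_v, λ_v⁻¹•mH_v, mG_v)` at `(γ_H)_v`: for almost all `v` the `G′`-side collapses to the single class of `γ_v`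
  (Kottwitz, ★ `eventually_integralConj_of_isRegularElt`) with unit orbital integral `1` (★ canonical normalisation off a finite set), and both transfer
  factors are `1` there (★ `IsAlmostEverywhereTrivial` of `Δ` from `hCTM`, of `Δ‴` from ★ `isAlmostEverywhereTrivial_finExplicitCollection_canonical`);
  the two identities then read `Φ^st_H = 1` and `λ_v⁻¹·Φ^st_H = 1`, so `λ_v = 1`;
* at such `v` the weak datum's `mH_v` IS canonical for the normalised measure, and the explicit unit fundamental lemma applies to `(mH v, mG v)`.
[Rogawski1990 §4.9 Prop. 4.9.1 (b) p. 55; §4.3 pp. 43–44 («`Δ_{G_v∕H_v} = 1` for almost all `v`»); §1.7 p. 6 (measures); Kottwitz1986 Prop. 7.1, Cor. 7.3.]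

* `isMulRightInvariant_endoscopicLocal` — every Haar measure on `H_v` is right invariant (§1);
* **`eventually_isLocalUnitTransfer_finExplicitCollection`** — the statement above (§2).

HONEST LABEL: HC_CM is proved only modulo the 7 printed citations (2 remaining named inputs: hLiu418 = stmt-HodgeConjecture-24832,
h413 = stmt-HodgeConjecture-24833) until rung 0 closes; this file consumes nothing printed (it uses the tree's PROVED explicit unit fundamental lemma).
-/

set_option autoImplicit false
set_option linter.dupNamespace false

noncomputable section

open MeasureTheory Measure NumberField IsDedekindDomain Filter Polynomial
open Literature.MeasureTheory.Group
open Literature.NumberTheory.Rogawski1990 Literature.NumberTheory.Automorphic Literature.NumberTheory.GaloisRepresentations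
open Literature.AlgebraicGeometry.ShimuraVarieties (unitaryGroup hermForm)
open scoped Matrix MatrixGroups ENNReal NNReal

namespace Summit.HodgeConjecture.HodgeConjecture.Cruxes.H413.K2E4WeakMatrixAlmostEverywhereAgreement

/-! ## §1 `H_v = U(Φ₂)(L⁺_v) × U(Φ₁)(L⁺_v)` is unimodular -/

section Unimodular

variable (L : Type) [Field L] [NumberField L] [IsCMField L] (v : HeightOneSpectrum (𝓞 ↥(maximalRealSubfield L)))

/-- `Φ₁ = (1)` is anisotropic: `x̄·x = 0 ⇒ x = 0`. [cite: Rogawski1990, §4.9 p. 54] -/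
theorem anisotropic_antidiagOne_one :
    ∀ x : Fin 1 → L, hermForm (cmConjRingHom L) (Matrix.of fun i j : Fin 1 => if i.val + j.val + 1 = 1 then (1 : L) else 0) x x = 0 → x = 0 := by
  intro x hx
  have h0 : cmConjRingHom L (x 0) * x 0 = 0 := by
    simpa [hermForm, dotProduct, Matrix.mulVec, Fin.sum_univ_one, Matrix.of_apply] using hx
  rcases mul_eq_zero.1 h0 with h | h
  · exact funext fun i => by rw [Subsingleton.elim i 0]; exact (map_eq_zero_iff _ (cmConjRingHom L).injective).1 h
  · exact funext fun i => by rw [Subsingleton.elim i 0]; exact h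

/-- **Every Haar measure on `H_v = U(Φ₂)(L⁺_v) × U(Φ₁)(L⁺_v)` is right invariant** (both factors are unimodular: ★ `modularCharacter_cmDatum_local_two_eq_one`,
★ `modularCharacter_cmDatum_local_eq_one_of_anisotropic'`; ★ `isMulRightInvariant_prod`), for any Borel structure on the product.
[cite: Rogawski1990, §1.7 p. 6; §4.9 p. 54] [cite: Folland1995, §2.4 Prop. 2.27] -/
theorem isMulRightInvariant_endoscopicLocal
    [MeasurableSpace ((UnitaryGroup.cmDatum L 2 (Matrix.of fun i j : Fin 2 => if i.val + j.val + 1 = 2 then (1 : L) else 0)).Local v ×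
      (UnitaryGroup.cmDatum L 1 (Matrix.of fun i j : Fin 1 => if i.val + j.val + 1 = 1 then (1 : L) else 0)).Local v)]
    [BorelSpace ((UnitaryGroup.cmDatum L 2 (Matrix.of fun i j : Fin 2 => if i.val + j.val + 1 = 2 then (1 : L) else 0)).Local v ×
      (UnitaryGroup.cmDatum L 1 (Matrix.of fun i j : Fin 1 => if i.val + j.val + 1 = 1 then (1 : L) else 0)).Local v)]
    (ν : Measure ((UnitaryGroup.cmDatum L 2 (Matrix.of fun i j : Fin 2 => if i.val + j.val + 1 = 2 then (1 : L) else 0)).Local v ×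
      (UnitaryGroup.cmDatum L 1 (Matrix.of fun i j : Fin 1 => if i.val + j.val + 1 = 1 then (1 : L) else 0)).Local v)) [ν.IsHaarMeasure] :
    ν.IsMulRightInvariant :=
  isMulRightInvariant_prod
    (fun a => UnitaryGroup.modularCharacter_cmDatum_local_two_eq_one L v _ (UnitaryGroup.antidiagOne_isHermitian L 2)
      (UnitaryGroup.isUnit_antidiagOne_det L 2).ne_zero a)
    (fun b => UnitaryGroup.modularCharacter_cmDatum_local_eq_one_of_anisotropic' L _ v (anisotropic_antidiagOne_one L) b) ν

end Unimodular

/-! ## §2 The explicit unit fundamental lemma for the weak datum's measure families, at almost every place -/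

section Frame

variable (L : Type) [Field L] [NumberField L] [IsCMField L] (H' : Matrix (Fin 3) (Fin 3) L)
    [∀ v : HeightOneSpectrum (𝓞 ↥(maximalRealSubfield L)), MeasurableSpace ((UnitaryGroup.cmDatum L 3 H').Local v)]
    [∀ v : HeightOneSpectrum (𝓞 ↥(maximalRealSubfield L)), BorelSpace ((UnitaryGroup.cmDatum L 3 H').Local v)]
    [∀ v : HeightOneSpectrum (𝓞 ↥(maximalRealSubfield L)), MeasurableSpace ((UnitaryGroup.cmDatum L 2 (Matrix.of fun i j : Fin 2 => if i.val + j.val + 1 = 2 then (1 : L) else 0)).Local v ×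
        (UnitaryGroup.cmDatum L 1 (Matrix.of fun i j : Fin 1 => if i.val + j.val + 1 = 1 then (1 : L) else 0)).Local v)]
    [∀ v : HeightOneSpectrum (𝓞 ↥(maximalRealSubfield L)), BorelSpace ((UnitaryGroup.cmDatum L 2 (Matrix.of fun i j : Fin 2 => if i.val + j.val + 1 = 2 then (1 : L) else 0)).Local v ×
        (UnitaryGroup.cmDatum L 1 (Matrix.of fun i j : Fin 1 => if i.val + j.val + 1 = 1 then (1 : L) else 0)).Local v)]
    (νH : ∀ v : HeightOneSpectrum (𝓞 ↥(maximalRealSubfield L)), Measure ((UnitaryGroup.cmDatum L 2 (Matrix.of fun i j : Fin 2 => if i.val + j.val + 1 = 2 then (1 : L) else 0)).Local v ×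
        (UnitaryGroup.cmDatum L 1 (Matrix.of fun i j : Fin 1 => if i.val + j.val + 1 = 1 then (1 : L) else 0)).Local v))
    (νG : ∀ v : HeightOneSpectrum (𝓞 ↥(maximalRealSubfield L)), Measure ((UnitaryGroup.cmDatum L 3 H').Local v))
    [∀ v, IsFiniteMeasureOnCompacts (νH v)] [∀ v, (νH v).IsMulRightInvariant]
    [∀ v, (νG v).IsHaarMeasure] [∀ v, (νG v).IsMulRightInvariant]

/-- **THE EXPLICIT UNIT FUNDAMENTAL LEMMA FOR THE WEAK DATUM'S CANONICAL FAMILIES, ALMOST EVERYWHERE.**  `H′` hermitian anisotropic, `νG_v(K′_v) = 1`,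
`(Sbad, Δ, mH, mG)` a weak transfer datum with ★ `CanonicalTransferMatrix L H′ Δ_∞ νH νG Sbad Δ mH mG` (any archimedean factor `Δ_∞`), `μ` a unitary Hecke
character of `L` with `μ|_{𝕀_{L⁺}} = ω_{L∕L⁺}`.  THEN for almost every finite place `v`, `1_{K_{H,v}}` is a `Δ‴_v`-transfer of `1_{K′_v}` for the datum's
OWN families `(mH v, mG v)`, `Δ‴ = finExplicitCollection L H′ μ` (★ `IsLocalUnitTransfer`).  Proof: §-docstring of this file (the weak datum forces
`νH_v(K_{H,v}) = 1` a.e.; then the tree's explicit unit fundamental lemma applies). [cite: Rogawski1990, §4.9 Prop. 4.9.1 (b) p. 55; §4.3 pp. 43–44; §1.7 p. 6]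
[cite: Kottwitz1986, Prop. 7.1, Cor. 7.3] -/
theorem eventually_isLocalUnitTransfer_finExplicitCollection
    [hMG : ∀ (v : HeightOneSpectrum (𝓞 ↥(maximalRealSubfield L))) (γ : (UnitaryGroup.cmDatum L 3 H').Local v),
      MeasurableSpace ((UnitaryGroup.cmDatum L 3 H').Local v ⧸ Subgroup.centralizer ({γ} : Set ((UnitaryGroup.cmDatum L 3 H').Local v)))]
    [hBG : ∀ (v : HeightOneSpectrum (𝓞 ↥(maximalRealSubfield L))) (γ : (UnitaryGroup.cmDatum L 3 H').Local v),
      BorelSpace ((UnitaryGroup.cmDatum L 3 H').Local v ⧸ Subgroup.centralizer ({γ} : Set ((UnitaryGroup.cmDatum L 3 H').Local v)))]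
    [hMH : ∀ (v : HeightOneSpectrum (𝓞 ↥(maximalRealSubfield L))) (a : ((UnitaryGroup.cmDatum L 2 (Matrix.of fun i j : Fin 2 => if i.val + j.val + 1 = 2 then (1 : L) else 0)).Local v ×
        (UnitaryGroup.cmDatum L 1 (Matrix.of fun i j : Fin 1 => if i.val + j.val + 1 = 1 then (1 : L) else 0)).Local v)),
      MeasurableSpace (((UnitaryGroup.cmDatum L 2 (Matrix.of fun i j : Fin 2 => if i.val + j.val + 1 = 2 then (1 : L) else 0)).Local v ×
        (UnitaryGroup.cmDatum L 1 (Matrix.of fun i j : Fin 1 => if i.val + j.val + 1 = 1 then (1 : L) else 0)).Local v) ⧸ Subgroup.centralizer ({a} : Set ((UnitaryGroup.cmDatum L 2 (Matrix.of fun i j : Fin 2 => if i.val + j.val + 1 = 2 then (1 : L) else 0)).Local v ×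
        (UnitaryGroup.cmDatum L 1 (Matrix.of fun i j : Fin 1 => if i.val + j.val + 1 = 1 then (1 : L) else 0)).Local v)))]
    [hBH : ∀ (v : HeightOneSpectrum (𝓞 ↥(maximalRealSubfield L))) (a : ((UnitaryGroup.cmDatum L 2 (Matrix.of fun i j : Fin 2 => if i.val + j.val + 1 = 2 then (1 : L) else 0)).Local v ×
        (UnitaryGroup.cmDatum L 1 (Matrix.of fun i j : Fin 1 => if i.val + j.val + 1 = 1 then (1 : L) else 0)).Local v)),
      BorelSpace (((UnitaryGroup.cmDatum L 2 (Matrix.of fun i j : Fin 2 => if i.val + j.val + 1 = 2 then (1 : L) else 0)).Local v ×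
        (UnitaryGroup.cmDatum L 1 (Matrix.of fun i j : Fin 1 => if i.val + j.val + 1 = 1 then (1 : L) else 0)).Local v) ⧸ Subgroup.centralizer ({a} : Set ((UnitaryGroup.cmDatum L 2 (Matrix.of fun i j : Fin 2 => if i.val + j.val + 1 = 2 then (1 : L) else 0)).Local v ×
        (UnitaryGroup.cmDatum L 1 (Matrix.of fun i j : Fin 1 => if i.val + j.val + 1 = 1 then (1 : L) else 0)).Local v)))]
    (Δinf : ↥(UnitaryGroup.arch (↥(maximalRealSubfield L)) L (IsCMField.complexConj L) 2 (Matrix.of fun i j : Fin 2 => if i.val + j.val + 1 = 2 then (1 : L) else 0)) ×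
        ↥(UnitaryGroup.arch (↥(maximalRealSubfield L)) L (IsCMField.complexConj L) 1 (Matrix.of fun i j : Fin 1 => if i.val + j.val + 1 = 1 then (1 : L) else 0)) →
      ↥(UnitaryGroup.arch (↥(maximalRealSubfield L)) L (IsCMField.complexConj L) 3 H') → ℂ)
    (hK : ∀ v : HeightOneSpectrum (𝓞 ↥(maximalRealSubfield L)), νG v (UnitaryGroup.cmLocalIntegralLevel L 3 H' v : Set ((UnitaryGroup.cmDatum L 3 H').Local v)) = 1)
    (hherm : (H'.map (cmConjRingHom L)).transpose = H') (hanis : ∀ x : Fin 3 → L, hermForm (cmConjRingHom L) H' x x = 0 → x = 0)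
    (Sbad : Finset (HeightOneSpectrum (𝓞 ↥(maximalRealSubfield L))))
    (Δ : ∀ v : HeightOneSpectrum (𝓞 ↥(maximalRealSubfield L)), LocalTransferFactor L H' v)
    (mH : ∀ v : HeightOneSpectrum (𝓞 ↥(maximalRealSubfield L)),
      OrbitalMeasureFamily ((UnitaryGroup.cmDatum L 2 (Matrix.of fun i j : Fin 2 => if i.val + j.val + 1 = 2 then (1 : L) else 0)).Local v ×
        (UnitaryGroup.cmDatum L 1 (Matrix.of fun i j : Fin 1 => if i.val + j.val + 1 = 1 then (1 : L) else 0)).Local v))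
    (mG : ∀ v : HeightOneSpectrum (𝓞 ↥(maximalRealSubfield L)), OrbitalMeasureFamily ((UnitaryGroup.cmDatum L 3 H').Local v))
    (hCTM : CanonicalTransferMatrix L H' Δinf νH νG Sbad Δ mH mG)
    (μ : HeckeCharacter L) (hμu : μ.IsUnitary)
    (hμω : ∀ x : ideleGroup ↥(maximalRealSubfield L), μ (AdeleRing.ideleBaseChange (↥(maximalRealSubfield L)) L x) = quadraticHeckeCharCM L x) :
    ∀ᶠ v : HeightOneSpectrum (𝓞 ↥(maximalRealSubfield L)) in cofinite,
      IsLocalUnitTransfer L H' v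
        (finExplicitCollection L H' μ (finExplicitDelta_conj_left_all L H' μ) (finExplicitDelta_conj_right_all L H' μ) v) (mH v) (mG v) := by
  classical
  /- Step 0: the orbit-quotient σ-algebras ARE the Borel ones; pin them (the explicit unit fundamental lemma is stated with `borel`). -/
  have eG : hMG = fun v γ => borel _ := funext fun v => funext fun γ => (hBG v γ).measurable_eq
  have eH : hMH = fun v a => borel _ := funext fun v => funext fun a => (hBH v a).measurable_eq
  subst eG eH
  letI iMG : ∀ (v : HeightOneSpectrum (𝓞 ↥(maximalRealSubfield L))) (γ : (UnitaryGroup.cmDatum L 3 H').Local v),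
      MeasurableSpace ((UnitaryGroup.cmDatum L 3 H').Local v ⧸ Subgroup.centralizer ({γ} : Set ((UnitaryGroup.cmDatum L 3 H').Local v))) :=
    fun _ _ => borel _
  haveI iBG : ∀ (v : HeightOneSpectrum (𝓞 ↥(maximalRealSubfield L))) (γ : (UnitaryGroup.cmDatum L 3 H').Local v),
      BorelSpace ((UnitaryGroup.cmDatum L 3 H').Local v ⧸ Subgroup.centralizer ({γ} : Set ((UnitaryGroup.cmDatum L 3 H').Local v))) :=
    fun _ _ => ⟨rfl⟩
  letI iMH : ∀ (v : HeightOneSpectrum (𝓞 ↥(maximalRealSubfield L))) (a : ((UnitaryGroup.cmDatum L 2 (Matrix.of fun i j : Fin 2 => if i.val + j.val + 1 = 2 then (1 : L) else 0)).Local v ×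
        (UnitaryGroup.cmDatum L 1 (Matrix.of fun i j : Fin 1 => if i.val + j.val + 1 = 1 then (1 : L) else 0)).Local v)),
      MeasurableSpace (((UnitaryGroup.cmDatum L 2 (Matrix.of fun i j : Fin 2 => if i.val + j.val + 1 = 2 then (1 : L) else 0)).Local v ×
        (UnitaryGroup.cmDatum L 1 (Matrix.of fun i j : Fin 1 => if i.val + j.val + 1 = 1 then (1 : L) else 0)).Local v) ⧸ Subgroup.centralizer ({a} : Set ((UnitaryGroup.cmDatum L 2 (Matrix.of fun i j : Fin 2 => if i.val + j.val + 1 = 2 then (1 : L) else 0)).Local v ×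
        (UnitaryGroup.cmDatum L 1 (Matrix.of fun i j : Fin 1 => if i.val + j.val + 1 = 1 then (1 : L) else 0)).Local v))) :=
    fun _ _ => borel _
  haveI iBH : ∀ (v : HeightOneSpectrum (𝓞 ↥(maximalRealSubfield L))) (a : ((UnitaryGroup.cmDatum L 2 (Matrix.of fun i j : Fin 2 => if i.val + j.val + 1 = 2 then (1 : L) else 0)).Local v ×
        (UnitaryGroup.cmDatum L 1 (Matrix.of fun i j : Fin 1 => if i.val + j.val + 1 = 1 then (1 : L) else 0)).Local v)),
      BorelSpace (((UnitaryGroup.cmDatum L 2 (Matrix.of fun i j : Fin 2 => if i.val + j.val + 1 = 2 then (1 : L) else 0)).Local v ×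
        (UnitaryGroup.cmDatum L 1 (Matrix.of fun i j : Fin 1 => if i.val + j.val + 1 = 1 then (1 : L) else 0)).Local v) ⧸ Subgroup.centralizer ({a} : Set ((UnitaryGroup.cmDatum L 2 (Matrix.of fun i j : Fin 2 => if i.val + j.val + 1 = 2 then (1 : L) else 0)).Local v ×
        (UnitaryGroup.cmDatum L 1 (Matrix.of fun i j : Fin 1 => if i.val + j.val + 1 = 1 then (1 : L) else 0)).Local v))) :=
    fun _ _ => ⟨rfl⟩
  /- Step 1: a rational `G`-regular matching pair `γ_H → γ`. -/
  obtain ⟨γH, γ, hreg, hpair⟩ := exists_isGRegular_isNormPair L H' hherm hanis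
  have hregγ : IsRegularElt (γ.val : GL (Fin 3) L) := isRegularElt_of_isConj (isNormPair_iff_isConj.1 hpair) hreg
  have hdet : H'.det ≠ 0 := Godement.det_ne_zero_of_anisotropic L H' hanis
  have hdetu : IsUnit H'.det := isUnit_iff_ne_zero.2 hdet
  have hregv : ∀ v, IsLocalGRegular L v (rationalComponent L γH v) := fun v => isLocalGRegular_rationalComponent L γH hreg v
  have hmatchv : ∀ v, IsLocalNormPair L H' v (rationalComponent L γH v)
      ((UnitaryGroup.cmDatum L 3 H').toLocal v ((UnitaryGroup.cmDatum L 3 H').toAdelic γ)) :=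
    fun v => hpair.isLocalNormPair_toLocal_toAdelic v
  /- Step 2: `νH_v` is a (two-sided) Haar measure; `λ_v = νH_v(K_{H,v}) ∈ (0, ∞)`; the normalised measures `νH₀ v = λ_v⁻¹ • νH v`. -/
  have hne : ∀ v, νH v ≠ 0 := by
    intro v hv0
    have hP := isLocalGRegular_out_mk_rationalComponent L γH hreg v
    obtain ⟨t, ht, hti, -, hm⟩ := (hCTM.1 v).2.2.1 _ hP
    have hz := ((hCTM.1 v).1.2.1 _ hP).1
    rw [hm] at hz
    exact hz (quotientMeasure_eq_zero_of_eq_zero _ _ t (νH v) hv0)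
  haveI hHaar : ∀ v, (νH v).IsHaarMeasure := fun v => by
    haveI := isMulRightInvariant_endoscopicLocal L v
      (haar : Measure ((UnitaryGroup.cmDatum L 2 (Matrix.of fun i j : Fin 2 => if i.val + j.val + 1 = 2 then (1 : L) else 0)).Local v ×
        (UnitaryGroup.cmDatum L 1 (Matrix.of fun i j : Fin 1 => if i.val + j.val + 1 = 1 then (1 : L) else 0)).Local v))
    exact isHaarMeasure_of_isMulRightInvariant_of_ne_zero haar (νH v) (hne v)
  have hKHco : ∀ v : HeightOneSpectrum (𝓞 ↥(maximalRealSubfield L)),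
      IsCompact ((((UnitaryGroup.cmLocalIntegralLevel L 2 (Matrix.of fun i j : Fin 2 => if i.val + j.val + 1 = 2 then (1 : L) else 0) v).prod
          (UnitaryGroup.cmLocalIntegralLevel L 1 (Matrix.of fun i j : Fin 1 => if i.val + j.val + 1 = 1 then (1 : L) else 0) v) :
            Subgroup ((UnitaryGroup.cmDatum L 2 (Matrix.of fun i j : Fin 2 => if i.val + j.val + 1 = 2 then (1 : L) else 0)).Local v ×
              (UnitaryGroup.cmDatum L 1 (Matrix.of fun i j : Fin 1 => if i.val + j.val + 1 = 1 then (1 : L) else 0)).Local v)) :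
          Set ((UnitaryGroup.cmDatum L 2 (Matrix.of fun i j : Fin 2 => if i.val + j.val + 1 = 2 then (1 : L) else 0)).Local v ×
            (UnitaryGroup.cmDatum L 1 (Matrix.of fun i j : Fin 1 => if i.val + j.val + 1 = 1 then (1 : L) else 0)).Local v))) ∧
      IsOpen ((((UnitaryGroup.cmLocalIntegralLevel L 2 (Matrix.of fun i j : Fin 2 => if i.val + j.val + 1 = 2 then (1 : L) else 0) v).prod
          (UnitaryGroup.cmLocalIntegralLevel L 1 (Matrix.of fun i j : Fin 1 => if i.val + j.val + 1 = 1 then (1 : L) else 0) v) :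
            Subgroup ((UnitaryGroup.cmDatum L 2 (Matrix.of fun i j : Fin 2 => if i.val + j.val + 1 = 2 then (1 : L) else 0)).Local v ×
              (UnitaryGroup.cmDatum L 1 (Matrix.of fun i j : Fin 1 => if i.val + j.val + 1 = 1 then (1 : L) else 0)).Local v)) :
          Set ((UnitaryGroup.cmDatum L 2 (Matrix.of fun i j : Fin 2 => if i.val + j.val + 1 = 2 then (1 : L) else 0)).Local v ×
            (UnitaryGroup.cmDatum L 1 (Matrix.of fun i j : Fin 1 => if i.val + j.val + 1 = 1 then (1 : L) else 0)).Local v))) := by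
    intro v
    have h₂ := UnitaryGroup.isCompact_isOpen_cmLocalIntegralLevel L 2 (Matrix.of fun i j : Fin 2 => if i.val + j.val + 1 = 2 then (1 : L) else 0) v
    have h₁ := UnitaryGroup.isCompact_isOpen_cmLocalIntegralLevel L 1 (Matrix.of fun i j : Fin 1 => if i.val + j.val + 1 = 1 then (1 : L) else 0) v
    rw [Subgroup.coe_prod]
    exact ⟨h₂.1.prod h₁.1, h₂.2.prod h₁.2⟩
  -- `λ_v`
  obtain ⟨lam, hlam⟩ : ∃ lam : HeightOneSpectrum (𝓞 ↥(maximalRealSubfield L)) → ℝ≥0∞, ∀ v, lam v =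
      νH v (((UnitaryGroup.cmLocalIntegralLevel L 2 (Matrix.of fun i j : Fin 2 => if i.val + j.val + 1 = 2 then (1 : L) else 0) v).prod
          (UnitaryGroup.cmLocalIntegralLevel L 1 (Matrix.of fun i j : Fin 1 => if i.val + j.val + 1 = 1 then (1 : L) else 0) v) :
            Subgroup ((UnitaryGroup.cmDatum L 2 (Matrix.of fun i j : Fin 2 => if i.val + j.val + 1 = 2 then (1 : L) else 0)).Local v ×
              (UnitaryGroup.cmDatum L 1 (Matrix.of fun i j : Fin 1 => if i.val + j.val + 1 = 1 then (1 : L) else 0)).Local v)) :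
          Set ((UnitaryGroup.cmDatum L 2 (Matrix.of fun i j : Fin 2 => if i.val + j.val + 1 = 2 then (1 : L) else 0)).Local v ×
            (UnitaryGroup.cmDatum L 1 (Matrix.of fun i j : Fin 1 => if i.val + j.val + 1 = 1 then (1 : L) else 0)).Local v)) :=
    ⟨_, fun v => rfl⟩
  have hlam0 : ∀ v, lam v ≠ 0 := fun v => by
    rw [hlam v]; exact ((hKHco v).2.measure_pos (νH v) ⟨1, Subgroup.one_mem _⟩).ne'
  have hlamt : ∀ v, lam v ≠ ⊤ := fun v => by
    rw [hlam v]; exact (hKHco v).1.measure_lt_top.ne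
  -- the normalised Haar measures (a TRANSPARENT local definition: `νH₀ v` unfolds to `(lam v)⁻¹ • νH v`)
  let νH₀ : ∀ v : HeightOneSpectrum (𝓞 ↥(maximalRealSubfield L)), Measure ((UnitaryGroup.cmDatum L 2 (Matrix.of fun i j : Fin 2 => if i.val + j.val + 1 = 2 then (1 : L) else 0)).Local v ×
        (UnitaryGroup.cmDatum L 1 (Matrix.of fun i j : Fin 1 => if i.val + j.val + 1 = 1 then (1 : L) else 0)).Local v) := fun v => (lam v)⁻¹ • νH v
  haveI hHaar₀ : ∀ v, (νH₀ v).IsHaarMeasure := fun v =>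
    IsHaarMeasure.smul (νH v) (ENNReal.inv_ne_zero.2 (hlamt v)) (ENNReal.inv_ne_top.2 (hlam0 v))
  haveI hRI₀ : ∀ v, (νH₀ v).IsMulRightInvariant := fun v => by
    change ((lam v)⁻¹ • νH v).IsMulRightInvariant; infer_instance
  have hKH₀ : ∀ v : HeightOneSpectrum (𝓞 ↥(maximalRealSubfield L)),
      νH₀ v (((UnitaryGroup.cmLocalIntegralLevel L 2 (Matrix.of fun i j : Fin 2 => if i.val + j.val + 1 = 2 then (1 : L) else 0) v).prod
          (UnitaryGroup.cmLocalIntegralLevel L 1 (Matrix.of fun i j : Fin 1 => if i.val + j.val + 1 = 1 then (1 : L) else 0) v) :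
            Subgroup ((UnitaryGroup.cmDatum L 2 (Matrix.of fun i j : Fin 2 => if i.val + j.val + 1 = 2 then (1 : L) else 0)).Local v ×
              (UnitaryGroup.cmDatum L 1 (Matrix.of fun i j : Fin 1 => if i.val + j.val + 1 = 1 then (1 : L) else 0)).Local v)) :
          Set ((UnitaryGroup.cmDatum L 2 (Matrix.of fun i j : Fin 2 => if i.val + j.val + 1 = 2 then (1 : L) else 0)).Local v ×
            (UnitaryGroup.cmDatum L 1 (Matrix.of fun i j : Fin 1 => if i.val + j.val + 1 = 1 then (1 : L) else 0)).Local v)) = 1 := fun v => by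
    change ((lam v)⁻¹ • νH v) _ = 1
    rw [Measure.smul_apply, smul_eq_mul, ← hlam v]
    exact ENNReal.inv_mul_cancel (hlam0 v) (hlamt v)
  /- Step 3: the tree's explicit unit fundamental lemma for the normalised measures. -/
  obtain ⟨S', hS'⟩ := (unitFundamentalLemmaExplicit_iff L H' μ νH₀ νG).1
    (unitFundamentalLemmaExplicitClosed_of_nonsplitClosed unitFundamentalLemmaExplicitNonsplitClosed_holds L H' μ νH₀ νG hμu hμω hherm hanis)
    hK hKH₀
  /- Step 4: the almost-everywhere data at the pair: Kottwitz (KC) at `γ`, the unit orbital integral `Φ_v([γ_v], 1_{K′_v}) = 1`, and the triviality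
     of both transfer factors at `((γ_H)_v, γ_v)`. -/
  have hcanG : ∀ v, (mG v).IsCanonical (fun x : (UnitaryGroup.cmDatum L 3 H').Local v => IsRegularElt (x.val : GL (Fin 3) (UnitaryGroup.LocalRing L v))) (νG v) :=
    fun v => (hCTM.1 v).2.2.2
  have hregloc : ∀ v, IsRegularElt ((((UnitaryGroup.cmDatum L 3 H').toLocal v ((UnitaryGroup.cmDatum L 3 H').toAdelic γ))).val :
      GL (Fin 3) (UnitaryGroup.LocalRing L v)) := fun v => by
    have h0 : (((γ.val : GL (Fin 3) L)) : Matrix (Fin 3) (Fin 3) L).charpoly.Separable := hregγ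
    refine (isRegularElt_iff _).2 ?_
    rw [UnitaryGroup.charpoly_toLocal_toAdelic_eq_map]
    exact h0.map
  have hPout : ∀ v, IsRegularElt ((Quotient.out (ConjClasses.mk ((UnitaryGroup.cmDatum L 3 H').toLocal v ((UnitaryGroup.cmDatum L 3 H').toAdelic γ)))).val :
      GL (Fin 3) (UnitaryGroup.LocalRing L v)) :=
    fun v => isRegularElt_of_isConj ((Subgroup.subtype _).map_isConj (isConj_out_conjClasses_mk _)) (hregloc v)
  obtain ⟨S₀, hS₀⟩ := UnitaryGroup.exists_isNormalisedOff_adelic_of_isCanonical L 3 H' mG hherm hdet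
    (fun v (x : (UnitaryGroup.cmDatum L 3 H').Local v) => IsRegularElt (x.val : GL (Fin 3) (UnitaryGroup.LocalRing L v))) νG hK hcanG
    _ hregγ ((UnitaryGroup.cmDatum L 3 H').toAdelic γ) (UnitaryGroup.charpoly_toLocal_toAdelic_eq_map L 3 H' γ) hPout
  have hKC := UnitaryGroup.eventually_integralConj_of_isRegularElt L 3 H' hherm hdet γ hregγ
  have hinv : ∀ v, SMulInvariantMeasure ((UnitaryGroup.cmDatum L 3 H').Local v) _
      (mG v (ConjClasses.mk ((UnitaryGroup.cmDatum L 3 H').toLocal v ((UnitaryGroup.cmDatum L 3 H').toAdelic γ)))) :=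
    fun v => ((hCTM.1 v).1.2.2.1 _ (hPout v)).2.1
  have hΦ1 := UnitaryGroup.eventually_classOrbitalIntegral_indicator_eq_one_of_integralConj L 3 H' mG γ hKC hinv hS₀
  have haeΔ := hCTM.2.1 γH ((UnitaryGroup.cmDatum L 3 H').toAdelic γ) hreg hmatchv
  have haeΔ3 := isAlmostEverywhereTrivial_finExplicitCollection_canonical L H' hherm hdetu μ γH
    ((UnitaryGroup.cmDatum L 3 H').toAdelic γ) hreg hmatchv
  /- Step 5: `λ_v = 1` almost everywhere. -/
  have hlam1 : ∀ᶠ v in cofinite, lam v = 1 := by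
    filter_upwards [hKC, hΦ1, haeΔ, haeΔ3, Sbad.eventually_cofinite_notMem, S'.eventually_cofinite_notMem] with v hkc hφ hΔ hΔ3 hvS hvS'
    -- the matching classes meeting `K′_v` reduce to the class of `γ_v`
    have huniq : ∀ k ∈ (UnitaryGroup.cmLocalIntegralLevel L 3 H' v : Set ((UnitaryGroup.cmDatum L 3 H').Local v)),
        IsLocalNormPair L H' v (rationalComponent L γH v) k →
          IsConj ((UnitaryGroup.cmDatum L 3 H').toLocal v ((UnitaryGroup.cmDatum L 3 H').toAdelic γ)) k := by
      intro k hk hmk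
      have h1 : IsConj (k.val : GL (Fin 3) (UnitaryGroup.LocalRing L v))
          (((UnitaryGroup.cmDatum L 3 H').toLocal v ((UnitaryGroup.cmDatum L 3 H').toAdelic γ)).val) :=
        (show IsConj _ _ from hmk).symm.trans (show IsConj _ _ from hmatchv v)
      obtain ⟨k', -, hk'⟩ := hkc k hk h1
      exact isConj_iff.2 ⟨k', hk'⟩
    have hΔ1 : (Δ v).Δ (rationalComponent L γH v) ((UnitaryGroup.cmDatum L 3 H').toLocal v ((UnitaryGroup.cmDatum L 3 H').toAdelic γ)) = 1 := hΔ
    have hΔ31 : (finExplicitCollection L H' μ (finExplicitDelta_conj_left_all L H' μ) (finExplicitDelta_conj_right_all L H' μ) v).Δ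
        (rationalComponent L γH v) ((UnitaryGroup.cmDatum L 3 H').toLocal v ((UnitaryGroup.cmDatum L 3 H').toAdelic γ)) = 1 := hΔ3
    -- (A_v): `hCTM`'s unit fundamental lemma at `(γ_H)_v`, collapsed: `Φ^st_H((γ_H)_v, 1_{K_H}; mH v) = 1`
    have hA := (hCTM.1 v).2.1 hvS (rationalComponent L γH v) (hregv v)
    rw [finsum_delta_mul_classOrbitalIntegral_indicator_eq_of_unique (Δ v) (mG v) _ _ _ huniq, hφ, mul_one, hΔ1] at hA
    -- (B_v): the explicit unit fundamental lemma for the rescaled family `λ_v⁻¹ • mH v`, collapsed: `λ_v⁻¹ · Φ^st_H(…) = 1`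
    have hκ0 : (lam v)⁻¹ ≠ 0 := ENNReal.inv_ne_zero.2 (hlamt v)
    have hκt : (lam v)⁻¹ ≠ ⊤ := ENNReal.inv_ne_top.2 (hlam0 v)
    have hcan0 : OrbitalMeasureFamily.IsCanonical (IsLocalGRegular L v) (νH₀ v) (fun c => (lam v)⁻¹ • mH v c) :=
      isCanonical_smul_family (hCTM.1 v).2.2.1 hκ0 hκt
    have hB := hS' v hvS' (fun c => (lam v)⁻¹ • mH v c) (mG v) hcan0 (hcanG v) (rationalComponent L γH v) (hregv v)
    rw [finsum_delta_mul_classOrbitalIntegral_indicator_eq_of_unique _ (mG v) _ _ _ huniq, hφ, mul_one, hΔ31,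
      stableOrbitalIntegralRel_smul_family, hA, mul_one] at hB
    have h1 : ((lam v)⁻¹).toReal = 1 := by exact_mod_cast hB
    exact ENNReal.inv_eq_one.1 ((ENNReal.toReal_eq_one_iff _).1 h1)
  /- Step 6: at such places `mH v` is canonical for the normalised measure, so the explicit unit fundamental lemma applies to `(mH v, mG v)`. -/
  filter_upwards [hlam1, S'.eventually_cofinite_notMem] with v hv1 hvS'
  have hκ0 : (lam v)⁻¹ ≠ 0 := ENNReal.inv_ne_zero.2 (hlamt v)
  have hκt : (lam v)⁻¹ ≠ ⊤ := ENNReal.inv_ne_top.2 (hlam0 v)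
  have hcan0 : OrbitalMeasureFamily.IsCanonical (IsLocalGRegular L v) (νH₀ v) (mH v) := by
    have h : OrbitalMeasureFamily.IsCanonical (IsLocalGRegular L v) (νH₀ v) (fun c => (lam v)⁻¹ • mH v c) :=
      isCanonical_smul_family (hCTM.1 v).2.2.1 hκ0 hκt
    have hm : (fun c => (lam v)⁻¹ • mH v c) = mH v := funext fun c => by rw [hv1, inv_one, one_smul]
    rwa [hm] at h
  exact hS' v hvS' (mH v) (mG v) hcan0 (hcanG v)

end Frame

end Summit.HodgeConjecture.HodgeConjecture.Cruxes.H413.K2E4WeakMatrixAlmostEverywhereAgreement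

end
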